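import Mathlib
import Summits.KontsevichZagierPeriods.Zeta5Search.DenomLaw.LongRegimeZL5Kit
import Summits.KontsevichZagierPeriods.Zeta5Search.DenomLaw.LawZACoverKit
import Summits.KontsevichZagierPeriods.Zeta5Search.DenomLaw.FullProfilePath
import Summits.KontsevichZagierPeriods.Zeta5Search.DenomLaw.Profile17aPath
import Summits.KontsevichZagierPeriods.Zeta5Search.DenomLaw.Profile16aPath
import Summits.KontsevichZagierPeriods.Zeta5Search.DenomLaw.Profile15aPath
import HarnessLib

/-!
# ζ(5) search — the DEEP cells of four long profiles CLOSED: the full profile at `4p ≤ d` (THEOREM ZL5, `−11`), `N_p = 17` branch `(1,5)` at `3p ≤ d` (THEOREM ZA, `−8`), `N_p = 16` branch `(1,6)` and `N_p = 15` branch `(1,7)` at `3p ≤ d` (THEOREM ZL5₈, `−7`) ⇒ PATH accounting on these profiles for EVERY `d` (DENOM-LAW D1, prover-d1 gen 22)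

Cell `pub-zeta5` (HONEST FRAMING: systematic search; no irrationality claim unless certified), TRACK «DENOM-LAW» D1 prover seat (denom-prover-d1
gen 22, `HOME/denom-law/prover-d1/ATTEMPT-22.md` §2).  Gens 17–19 proved the ∀-`b` node `DenomLaw.PathAccountingFirstPeriod` on the a = 7 profiles
`N_p ∈ {21, …, 15}` for every sorted `b`, but with a DEPTH RESTRICTION on four of them, because the node there sits one unit above the deepest law then
in the tree: the full profile (`pathAccounting_fullProfile`, `d < 4p`; corner node `−11`, L5 gives `−12`), and the branches through the largest parameter
`N_p = 17` `(1,2),…,(1,5)` (`pathAccounting_profile17a`, `d < 3p`; node `−8`, A⁗ `−9`), `N_p = 16` `(1,2),…,(1,6)` (`…16a`, `d < 3p`; node `−7`, L5₈ `−8`),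
`N_p = 15` `(1,2),…,(1,7)` (`…15a`, `d < 3p`; node `−7`, L5₈ `−8`).  The laws landed since — THEOREM ZA (gen 20, `lawZeroPointA4`, `8 − 2M`) and
THEOREM ZL5 / ZL5₈ (gen 21, `lawZeroPointA5(_depth8)`, `9 − 2M`) — supply exactly that unit, and the machine-generated covers of gens 17/18
(`FullProfile.cover_ev/od`, `cover17a_*`, `cover16a_*`, `cover15a_*`) ALREADY pass the required spelled-out checks (zero-point structure
`(M; [T], [])` with the virtual deep palindrome `T = [1,−6,−6,1]` resp. `[1,−5,−5,1]`, gen 3's six L5 clauses resp. the five A⁗′ clauses; `decide`):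
* `cas_ge_neg11` — full profile, `4p ≤ d`: ZL5₈-kit at `(10, [1,−6,−6,1])` (gen 22's `DenomLaw.cover_ZL5d8_long`), `9 − 20 = −11`;
* `cas_ge17a_neg8` — `N_p = 17` branch `(1,5)`, `3p ≤ d`: ZA (gen 20's `DenomLaw.cover_ZA`) at `(8, [1,−5,−5,1])`, `8 − 16 = −8`;
* `cas_ge16a_neg7`, `cas_ge15a_neg7` — `3p ≤ d`: ZL5₈-kit at `(8, [1,−5,−5,1])`, `9 − 16 = −7`;
and, with `d < 5p` on the full profile (`d_lt_five_fullProfile`) and the landed `d`-restricted theorems below the thresholds, the node WITHOUT any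
hypothesis on `d`: **`pathAccounting_fullProfile_all`**, **`pathAccounting_profile17a_all`**, **`pathAccounting_profile16a_all`**,
**`pathAccounting_profile15a_all`** (every `j`) and the `j = 7` statements with the node's binders VERBATIM plus the profile inequalities only
(`pathAccountingFirstPeriod_fullProfile_all`, `…_profile17a_all`, `…_profile16a_all`, `…_profile15a_all`).  Census beside the proof (gen 22, classifier
`g21/code/census.py` on the exhaustive a = 7 enumeration at `p = 7, 11` and a 30 % sample at `p = 13`): full-profile corner 516 instances — ZL5 at `M = 10`
on all; 17a at `⌊d/p⌋ = 3` 113 — ZA at `M = 8` on all; 16a 49 and 15a 106 — ZL5₈ at `M = 8` on all; against gen 18's exact valuations (the 71 of these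
instances in its tables, `p ≤ 13`): `v = node` on 66, `v = node + 1` on 5 (15a, `p = 7`), never below.
MODEL/structure-side valuation bookkeeping of the cell's own rationals; nothing about ζ(5); no γ; records in print UNMOVED.
-/

open Finset

namespace Summit.KontsevichZagierPeriods.Zeta5Search.FullProfile

open Summit.KontsevichZagierPeriods.Zeta5Search.ClusterValuation
open Summit.KontsevichZagierPeriods.Zeta5Search.CasoratianValuation (InPolytope shift casoratian pairFloors refund)
open Summit.KontsevichZagierPeriods.Zeta5Search.WedgeDictionary (dOf)
open Summit.KontsevichZagierPeriods.Zeta5Search.ClassTypeCover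
open Summit.KontsevichZagierPeriods.Zeta5Search.DenomLaw (cStar FirstPeriod Sorted7 checkL5 cover_ZA cover_ZL5d8_long)
open Summit.KontsevichZagierPeriods.Zeta5Search.DenomLaw.FirstPeriodKit (cStar_le_eleven sorted7_chain)
open Summit.KontsevichZagierPeriods.Zeta5Search.SecondOrder (isRaise isRaise2)
open Summit.KontsevichZagierPeriods.Zeta5Search.SortedProfile

/-! ## §1 The full profile at `4p ≤ d` -/

section Bounds

variable {b : ℕ → ℤ} {j p : ℕ}

/-- On the full profile `d(b) < 5p`: `3b₀ < 6p + 3b₆ + 3b₇` and `b₁, …, b₅ ≥ b₆ ≥ b₇ ≥ p`. -/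
theorem d_lt_five_fullProfile (hs : Sorted7 b) (hP : (p : ℤ) ≤ b 7) (hF2 : b 0 < 2 * (p : ℤ) + b 6 + b 7) : dOf b < 5 * (p : ℤ) := by
  obtain ⟨h21, h32, h43, h54, h65, h76⟩ := sorted7_chain hs
  rw [DecompositionWholeCone.dOf_expand]; linarith

/-- All seven parameters reach `p` once the least one does. -/
theorem long_of_sorted (hs : Sorted7 b) (hP : (p : ℤ) ≤ b 7) : ∀ i ∈ range 7, (p : ℤ) ≤ b (i + 1) := by
  obtain ⟨h21, h32, h43, h54, h65, h76⟩ := sorted7_chain hs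
  intro i hi
  have hi7 := mem_range.1 hi
  interval_cases i <;> simp only [Nat.reduceAdd] <;> linarith

/-- **THEOREM ZL5 on the full profile at `4p ≤ d`, general `b`**: `v_p(Cas_j(b)) ≥ −11 = 9 − 2M` in the frame `(10, [1,−6,−6,1])` — the corner left open by
`pathAccounting_fullProfile` (gen 17: exact valuations `−11` there, «an uncatalogued rung» then; it is gen 21's THEOREM ZL5). -/
theorem cas_ge_neg11 (hb : InPolytope b) (hs : Sorted7 b) (hbj : InPolytope (shift b j)) (hj1 : 1 ≤ j) (hj7 : j ≤ 7)
    (hprime : p.Prime) (hp5 : 5 ≤ p) (hwin : (b 0 + 2 : ℤ) < (p : ℤ) ^ 2) (hP : (p : ℤ) ≤ b 7) (hQ : (p : ℤ) + b 1 + b 2 ≤ b 0)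
    (hF1 : b 1 < 2 * (p : ℤ)) (hF2 : b 0 < 2 * (p : ℤ) + b 6 + b 7) (hd : 4 * (p : ℤ) ≤ dOf b) (hcas : casoratian b j ≠ 0) :
    (-11 : ℤ) ≤ padicValRat p (casoratian b j) := by
  haveI : Fact p.Prime := ⟨hprime⟩
  have hp2 : p % 2 = 1 := Nat.odd_iff.1 (hprime.odd_of_ne_two (by omega))
  obtain ⟨h0, hb1, hb2, -, -, -, -, -, -⟩ := box hb
  have hpb : (p : ℤ) ≤ b 0 := by linarith
  have hlong := long_of_sorted hs hP
  have hdeg : (p : ℤ) * (((10 : ℕ) : ℤ) - 2) ≤ 2 * dOf b + 1 := by push_cast; linarith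
  have hD : ∀ T ∈ ([[1, -6, -6, 1]] : List (List ℤ)), T.reverse = T := by decide
  rcases Int.emod_two_eq_zero_or_one (b 0) with hr | hr
  · exact cover_ZL5d8_long hb hbj hj1 hj7 hprime hp5 hpb hwin hlong (cover_ev hb hs hP hQ hF1 hF2 hp5 hp2 hr) (M := 10) (by norm_num)
      (by decide) hD (S := []) (by decide) (by rw [oddFlag_false hr]; decide) hdeg (T := [1, -6, -6, 1]) (by decide)
      (by rw [oddFlag_false hr]; exact checkL5_ev) (by norm_num) hcas
  · exact cover_ZL5d8_long hb hbj hj1 hj7 hprime hp5 hpb hwin hlong (cover_od hb hs hP hQ hF1 hF2 hp5 hp2 hr) (M := 10) (by norm_num)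
      (by decide) hD (S := []) (by decide) (by rw [oddFlag_true hr]; decide) hdeg (T := [1, -6, -6, 1]) (by decide)
      (by rw [oddFlag_true hr]; exact checkL5_od) (by norm_num) hcas

/-! ## §2 The `N_p = 17` branch `(1,5)` at `3p ≤ d` -/

/-- **THEOREM ZA on the `N_p = 17` branch `(1,2),…,(1,5)` at `3p ≤ d`, general `b`**: `v_p(Cas_j(b)) ≥ −8 = 8 − 2M` in the frame `(8, [1,−5,−5,1])`
(zero-point structure `(8; D8, [])` and the five A⁗′ clauses on gen 18's covers; THEOREM L5's shape clause FAILS on this branch, ZA does not need it). -/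
theorem cas_ge17a_neg8 (hb : InPolytope b) (hs : Sorted7 b) (hbj : InPolytope (shift b j)) (hj1 : 1 ≤ j) (hj7 : j ≤ 7)
    (hprime : p.Prime) (hp5 : 5 ≤ p) (hwin : (b 0 + 2 : ℤ) < (p : ℤ) ^ 2) (hP : (p : ℤ) ≤ b 7) (hQ : b 0 < (p : ℤ) + b 1 + b 5)
    (hQ6 : (p : ℤ) + b 1 + b 6 ≤ b 0) (hQ23 : (p : ℤ) + b 2 + b 3 ≤ b 0) (hF1 : b 1 < 2 * (p : ℤ)) (hF2 : b 0 < 2 * (p : ℤ) + b 6 + b 7)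
    (hd : 3 * (p : ℤ) ≤ dOf b) (hcas : casoratian b j ≠ 0) : (-8 : ℤ) ≤ padicValRat p (casoratian b j) := by
  haveI : Fact p.Prime := ⟨hprime⟩
  have hp2 : p % 2 = 1 := Nat.odd_iff.1 (hprime.odd_of_ne_two (by omega))
  obtain ⟨h0, hb1, hb2, hb3, hb4, hb5, hb6, hb7, -⟩ := box hb
  have hpb : (p : ℤ) ≤ b 0 := by linarith
  have hdeg : (p : ℤ) * (((8 : ℕ) : ℤ) - 2) ≤ 2 * dOf b + 1 := by push_cast; linarith
  rcases Int.emod_two_eq_zero_or_one (b 0) with hr | hr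
  · exact cover_ZA hb hbj hj1 hj7 hprime hp5 hpb hwin (cover17a_ev hb hs hP hQ hQ6 hQ23 hF1 hF2 hp5 hp2 hr) (M := 8) (by norm_num)
      (by decide) T1Rays.d8_pal (S := []) (by decide) (by rw [oddFlag_false hr]; decide) hdeg (T := [1, -5, -5, 1]) (by decide)
      (by rw [oddFlag_false hr]; decide) (by norm_num) hcas
  · exact cover_ZA hb hbj hj1 hj7 hprime hp5 hpb hwin (cover17a_od hb hs hP hQ hQ6 hQ23 hF1 hF2 hp5 hp2 hr) (M := 8) (by norm_num)
      (by decide) T1Rays.d8_pal (S := []) (by decide) (by rw [oddFlag_true hr]; decide) hdeg (T := [1, -5, -5, 1]) (by decide)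
      (by rw [oddFlag_true hr]; decide) (by norm_num) hcas

/-! ## §3 The `N_p = 16` branch `(1,6)` and the `N_p = 15` branch `(1,7)` at `3p ≤ d` -/

/-- **THEOREM ZL5₈ on the `N_p = 16` branch `(1,2),…,(1,6)` at `3p ≤ d`, general `b`**: `v_p(Cas_j(b)) ≥ −7 = 9 − 2M` in the frame `(8, [1,−5,−5,1])`. -/
theorem cas_ge16a_neg7 (hb : InPolytope b) (hs : Sorted7 b) (hbj : InPolytope (shift b j)) (hj1 : 1 ≤ j) (hj7 : j ≤ 7)
    (hprime : p.Prime) (hp5 : 5 ≤ p) (hwin : (b 0 + 2 : ℤ) < (p : ℤ) ^ 2) (hP : (p : ℤ) ≤ b 7) (hQ : b 0 < (p : ℤ) + b 1 + b 6)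
    (hQ7 : (p : ℤ) + b 1 + b 7 ≤ b 0) (hQ23 : (p : ℤ) + b 2 + b 3 ≤ b 0) (hF1 : b 1 < 2 * (p : ℤ)) (hF2 : b 0 < 2 * (p : ℤ) + b 6 + b 7)
    (hd : 3 * (p : ℤ) ≤ dOf b) (hcas : casoratian b j ≠ 0) : (-7 : ℤ) ≤ padicValRat p (casoratian b j) := by
  haveI : Fact p.Prime := ⟨hprime⟩
  have hp2 : p % 2 = 1 := Nat.odd_iff.1 (hprime.odd_of_ne_two (by omega))
  obtain ⟨h0, hb1, hb2, -, -, -, -, -, -⟩ := box hb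
  have hpb : (p : ℤ) ≤ b 0 := by linarith
  have hlong := long_of_sorted hs hP
  have hdeg : (p : ℤ) * (((8 : ℕ) : ℤ) - 2) ≤ 2 * dOf b + 1 := by push_cast; linarith
  rcases Int.emod_two_eq_zero_or_one (b 0) with hr | hr
  · exact cover_ZL5d8_long hb hbj hj1 hj7 hprime hp5 hpb hwin hlong (cover16a_ev hb hs hP hQ hQ7 hQ23 hF1 hF2 hp5 hp2 hr) (M := 8)
      (by norm_num) (by decide) T1Rays.d8_pal (S := []) (by decide) (by rw [oddFlag_false hr]; decide) hdeg (T := [1, -5, -5, 1])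
      (by decide) (by rw [oddFlag_false hr]; decide) (by norm_num) hcas
  · exact cover_ZL5d8_long hb hbj hj1 hj7 hprime hp5 hpb hwin hlong (cover16a_od hb hs hP hQ hQ7 hQ23 hF1 hF2 hp5 hp2 hr) (M := 8)
      (by norm_num) (by decide) T1Rays.d8_pal (S := []) (by decide) (by rw [oddFlag_true hr]; decide) hdeg (T := [1, -5, -5, 1])
      (by decide) (by rw [oddFlag_true hr]; decide) (by norm_num) hcas

/-- **THEOREM ZL5₈ on the `N_p = 15` branch `(1,2),…,(1,7)` at `3p ≤ d`, general `b`**: `v_p(Cas_j(b)) ≥ −7 = 9 − 2M` in the frame `(8, [1,−5,−5,1])`. -/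
theorem cas_ge15a_neg7 (hb : InPolytope b) (hs : Sorted7 b) (hbj : InPolytope (shift b j)) (hj1 : 1 ≤ j) (hj7 : j ≤ 7)
    (hprime : p.Prime) (hp5 : 5 ≤ p) (hwin : (b 0 + 2 : ℤ) < (p : ℤ) ^ 2) (hP : (p : ℤ) ≤ b 7) (hQ : b 0 < (p : ℤ) + b 1 + b 7)
    (hQ23 : (p : ℤ) + b 2 + b 3 ≤ b 0) (hF1 : b 1 < 2 * (p : ℤ)) (hF2 : b 0 < 2 * (p : ℤ) + b 6 + b 7)
    (hd : 3 * (p : ℤ) ≤ dOf b) (hcas : casoratian b j ≠ 0) : (-7 : ℤ) ≤ padicValRat p (casoratian b j) := by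
  haveI : Fact p.Prime := ⟨hprime⟩
  have hp2 : p % 2 = 1 := Nat.odd_iff.1 (hprime.odd_of_ne_two (by omega))
  obtain ⟨h21, h32, h43, h54, h65, h76⟩ := sorted7_chain hs
  obtain ⟨h0, hb1, hb2, -, -, -, -, -, -⟩ := box hb
  have hpb : (p : ℤ) ≤ b 0 := by linarith
  have hlong := long_of_sorted hs hP
  have hdeg : (p : ℤ) * (((8 : ℕ) : ℤ) - 2) ≤ 2 * dOf b + 1 := by push_cast; linarith
  rcases Int.emod_two_eq_zero_or_one (b 0) with hr | hr
  · exact cover_ZL5d8_long hb hbj hj1 hj7 hprime hp5 hpb hwin hlong (cover15a_ev hb hs hP hQ hQ23 hF1 hF2 hp5 hp2 hr) (M := 8)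
      (by norm_num) (by decide) T1Rays.d8_pal (S := []) (by decide) (by rw [oddFlag_false hr]; decide) hdeg (T := [1, -5, -5, 1])
      (by decide) (by rw [oddFlag_false hr]; decide) (by norm_num) hcas
  · exact cover_ZL5d8_long hb hbj hj1 hj7 hprime hp5 hpb hwin hlong (cover15a_od hb hs hP hQ hQ23 hF1 hF2 hp5 hp2 hr) (M := 8)
      (by norm_num) (by decide) T1Rays.d8_pal (S := []) (by decide) (by rw [oddFlag_true hr]; decide) hdeg (T := [1, -5, -5, 1])
      (by decide) (by rw [oddFlag_true hr]; decide) (by norm_num) hcas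

end Bounds

/-! ## §4 PATH accounting on the four profiles WITHOUT a depth hypothesis -/

/-- **`PathAccountingFirstPeriod`'s conclusion on the FULL PROFILE, every sorted `b`, every direction `j`, EVERY `d`** (gen 17's `pathAccounting_fullProfile`
below `4p`, `cas_ge_neg11` at the corner `4p ≤ d < 5p`, where the node asks `4 − 21 + 6 = −11`). -/
theorem pathAccounting_fullProfile_all (b : ℕ → ℤ) (j p : ℕ) (hb : InPolytope b) (hs : Sorted7 b) (hbj : InPolytope (shift b j))
    (hj1 : 1 ≤ j) (hj7 : j ≤ 7) (hprime : p.Prime) (hp5 : 5 ≤ p) (hwin : (b 0 + 2 : ℤ) < (p : ℤ) ^ 2) (hfp : FirstPeriod b p)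
    (hP : (p : ℤ) ≤ b 7) (hQ : (p : ℤ) + b 1 + b 2 ≤ b 0) (hcas : casoratian b j ≠ 0) :
    dOf b / (p : ℤ) - pairFloors b p - min (if 2 ≤ dOf b / (p : ℤ) then (1 : ℤ) else 0) (5 - (cStar b p : ℤ))
      ≤ padicValRat p (casoratian b j) := by
  by_cases hd4 : dOf b < 4 * (p : ℤ)
  · exact pathAccounting_fullProfile b j p hb hs hbj hj1 hj7 hprime hp5 hwin hfp hP hQ hd4 hcas
  push Not at hd4
  obtain ⟨hF1, hF2⟩ := fp_bounds hfp
  have hp0 : (0 : ℤ) < p := by exact_mod_cast hprime.pos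
  rw [pairFloors_eq_21 hs hprime.pos (by linarith) hfp]
  have hC11 : (cStar b p : ℤ) ≤ 11 := by exact_mod_cast cStar_le_eleven b p
  have hmin : -6 ≤ min (if 2 ≤ dOf b / (p : ℤ) then (1 : ℤ) else 0) (5 - (cStar b p : ℤ)) :=
    le_min (by split_ifs <;> norm_num) (by linarith)
  have hfd : dOf b / (p : ℤ) < 5 := by rw [Int.ediv_lt_iff_lt_mul hp0]; linarith [d_lt_five_fullProfile hs hP hF2]
  linarith [cas_ge_neg11 hb hs hbj hj1 hj7 hprime hp5 hwin hP hQ hF1 hF2 hd4 hcas]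

/-- **THE NODE ON THE FULL PROFILE, EVERY SORTED `b`, EVERY `d`: `PathAccountingFirstPeriod` with its binders VERBATIM plus `p ≤ b₇` and `p + b₁ + b₂ ≤ b₀`
(all 28 forms reach `p`) — no hypothesis on `d(b)`.** -/
theorem pathAccountingFirstPeriod_fullProfile_all :
    ∀ (b : ℕ → ℤ) (p : ℕ), InPolytope b → Sorted7 b → InPolytope (shift b 7) →
      p.Prime → 5 ≤ p → (b 0 + 2 : ℤ) < (p : ℤ) ^ 2 → FirstPeriod b p →
      (p : ℤ) ≤ b 7 → (p : ℤ) + b 1 + b 2 ≤ b 0 → casoratian b 7 ≠ 0 →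
        dOf b / (p : ℤ) - pairFloors b p - min (if 2 ≤ dOf b / (p : ℤ) then (1 : ℤ) else 0) (5 - (cStar b p : ℤ))
          ≤ padicValRat p (casoratian b 7) :=
  fun b p hb hs hb7 hprime hp5 hwin hfp hP hQ hcas =>
    pathAccounting_fullProfile_all b 7 p hb hs hb7 (by norm_num) (by norm_num) hprime hp5 hwin hfp hP hQ hcas

/-- **`PathAccountingFirstPeriod`'s conclusion on the `N_p = 17` branch `(1,2),…,(1,5)`, every sorted `b`, every `j`, EVERY `d`** (gen 18's theorem below `3p`,
`cas_ge17a_neg8` at `3p ≤ d < 4p`, where the node asks `3 − 17 + 6 = −8`). -/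
theorem pathAccounting_profile17a_all (b : ℕ → ℤ) (j p : ℕ) (hb : InPolytope b) (hs : Sorted7 b) (hbj : InPolytope (shift b j))
    (hj1 : 1 ≤ j) (hj7 : j ≤ 7) (hprime : p.Prime) (hp5 : 5 ≤ p) (hwin : (b 0 + 2 : ℤ) < (p : ℤ) ^ 2) (hfp : FirstPeriod b p)
    (hP : (p : ℤ) ≤ b 7) (hQ : b 0 < (p : ℤ) + b 1 + b 5) (hQ6 : (p : ℤ) + b 1 + b 6 ≤ b 0) (hQ23 : (p : ℤ) + b 2 + b 3 ≤ b 0)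
    (hcas : casoratian b j ≠ 0) :
    dOf b / (p : ℤ) - pairFloors b p - min (if 2 ≤ dOf b / (p : ℤ) then (1 : ℤ) else 0) (5 - (cStar b p : ℤ))
      ≤ padicValRat p (casoratian b j) := by
  by_cases hd3 : dOf b < 3 * (p : ℤ)
  · exact pathAccounting_profile17a b j p hb hs hbj hj1 hj7 hprime hp5 hwin hfp hP hQ hQ6 hQ23 hd3 hcas
  push Not at hd3
  obtain ⟨hF1, hF2⟩ := fp_bounds hfp
  have hp0 : (0 : ℤ) < p := by exact_mod_cast hprime.pos
  rw [pairFloors_eq_17a hb hs hprime.pos hQ hQ6 hQ23 hfp]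
  have hC11 : (cStar b p : ℤ) ≤ 11 := by exact_mod_cast cStar_le_eleven b p
  have hmin : -6 ≤ min (if 2 ≤ dOf b / (p : ℤ) then (1 : ℤ) else 0) (5 - (cStar b p : ℤ)) :=
    le_min (by split_ifs <;> norm_num) (by linarith)
  have hfd : dOf b / (p : ℤ) < 4 := by rw [Int.ediv_lt_iff_lt_mul hp0]; linarith [(d_bounds17a hs hP hQ hQ6 hQ23 hF1).2]
  linarith [cas_ge17a_neg8 hb hs hbj hj1 hj7 hprime hp5 hwin hP hQ hQ6 hQ23 hF1 hF2 hd3 hcas]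

/-- **THE NODE ON THE `N_p = 17` BRANCH `(1,5)`, EVERY SORTED `b`, EVERY `d`** (binders VERBATIM plus the profile inequalities). -/
theorem pathAccountingFirstPeriod_profile17a_all :
    ∀ (b : ℕ → ℤ) (p : ℕ), InPolytope b → Sorted7 b → InPolytope (shift b 7) →
      p.Prime → 5 ≤ p → (b 0 + 2 : ℤ) < (p : ℤ) ^ 2 → FirstPeriod b p →
      (p : ℤ) ≤ b 7 → b 0 < (p : ℤ) + b 1 + b 5 → (p : ℤ) + b 1 + b 6 ≤ b 0 → (p : ℤ) + b 2 + b 3 ≤ b 0 → casoratian b 7 ≠ 0 →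
        dOf b / (p : ℤ) - pairFloors b p - min (if 2 ≤ dOf b / (p : ℤ) then (1 : ℤ) else 0) (5 - (cStar b p : ℤ))
          ≤ padicValRat p (casoratian b 7) :=
  fun b p hb hs hb7 hprime hp5 hwin hfp hP hQ hQ6 hQ23 hcas =>
    pathAccounting_profile17a_all b 7 p hb hs hb7 (by norm_num) (by norm_num) hprime hp5 hwin hfp hP hQ hQ6 hQ23 hcas

/-- **`PathAccountingFirstPeriod`'s conclusion on the `N_p = 16` branch `(1,2),…,(1,6)`, every sorted `b`, every `j`, EVERY `d`** (gen 18's theorem below `3p`,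
`cas_ge16a_neg7` at `3p ≤ d < 4p`, where the node asks `3 − 16 + 6 = −7`). -/
theorem pathAccounting_profile16a_all (b : ℕ → ℤ) (j p : ℕ) (hb : InPolytope b) (hs : Sorted7 b) (hbj : InPolytope (shift b j))
    (hj1 : 1 ≤ j) (hj7 : j ≤ 7) (hprime : p.Prime) (hp5 : 5 ≤ p) (hwin : (b 0 + 2 : ℤ) < (p : ℤ) ^ 2) (hfp : FirstPeriod b p)
    (hP : (p : ℤ) ≤ b 7) (hQ : b 0 < (p : ℤ) + b 1 + b 6) (hQ7 : (p : ℤ) + b 1 + b 7 ≤ b 0) (hQ23 : (p : ℤ) + b 2 + b 3 ≤ b 0)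
    (hcas : casoratian b j ≠ 0) :
    dOf b / (p : ℤ) - pairFloors b p - min (if 2 ≤ dOf b / (p : ℤ) then (1 : ℤ) else 0) (5 - (cStar b p : ℤ))
      ≤ padicValRat p (casoratian b j) := by
  by_cases hd3 : dOf b < 3 * (p : ℤ)
  · exact pathAccounting_profile16a b j p hb hs hbj hj1 hj7 hprime hp5 hwin hfp hP hQ hQ7 hQ23 hd3 hcas
  push Not at hd3
  obtain ⟨hF1, hF2⟩ := fp_bounds hfp
  have hp0 : (0 : ℤ) < p := by exact_mod_cast hprime.pos
  rw [pairFloors_eq_16a hb hs hprime.pos hQ hQ7 hQ23 hfp]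
  have hC11 : (cStar b p : ℤ) ≤ 11 := by exact_mod_cast cStar_le_eleven b p
  have hmin : -6 ≤ min (if 2 ≤ dOf b / (p : ℤ) then (1 : ℤ) else 0) (5 - (cStar b p : ℤ)) :=
    le_min (by split_ifs <;> norm_num) (by linarith)
  have hfd : dOf b / (p : ℤ) < 4 := by rw [Int.ediv_lt_iff_lt_mul hp0]; linarith [(d_bounds16a hs hP hQ hQ7 hQ23 hF1).2]
  linarith [cas_ge16a_neg7 hb hs hbj hj1 hj7 hprime hp5 hwin hP hQ hQ7 hQ23 hF1 hF2 hd3 hcas]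

/-- **THE NODE ON THE `N_p = 16` BRANCH `(1,6)`, EVERY SORTED `b`, EVERY `d`** (binders VERBATIM plus the profile inequalities). -/
theorem pathAccountingFirstPeriod_profile16a_all :
    ∀ (b : ℕ → ℤ) (p : ℕ), InPolytope b → Sorted7 b → InPolytope (shift b 7) →
      p.Prime → 5 ≤ p → (b 0 + 2 : ℤ) < (p : ℤ) ^ 2 → FirstPeriod b p →
      (p : ℤ) ≤ b 7 → b 0 < (p : ℤ) + b 1 + b 6 → (p : ℤ) + b 1 + b 7 ≤ b 0 → (p : ℤ) + b 2 + b 3 ≤ b 0 → casoratian b 7 ≠ 0 →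
        dOf b / (p : ℤ) - pairFloors b p - min (if 2 ≤ dOf b / (p : ℤ) then (1 : ℤ) else 0) (5 - (cStar b p : ℤ))
          ≤ padicValRat p (casoratian b 7) :=
  fun b p hb hs hb7 hprime hp5 hwin hfp hP hQ hQ7 hQ23 hcas =>
    pathAccounting_profile16a_all b 7 p hb hs hb7 (by norm_num) (by norm_num) hprime hp5 hwin hfp hP hQ hQ7 hQ23 hcas

/-- **`PathAccountingFirstPeriod`'s conclusion on the `N_p = 15` branch `(1,2),…,(1,7)`, every sorted `b`, every `j`, EVERY `d`** (gen 18's theorem below `3p`,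
`cas_ge15a_neg7` at `3p ≤ d < 4p`, where — `C⋆ ≤ 10` on this branch, `cStar_le_ten_15a` — the node asks `3 − 15 + 5 = −7`). -/
theorem pathAccounting_profile15a_all (b : ℕ → ℤ) (j p : ℕ) (hb : InPolytope b) (hs : Sorted7 b) (hbj : InPolytope (shift b j))
    (hj1 : 1 ≤ j) (hj7 : j ≤ 7) (hprime : p.Prime) (hp5 : 5 ≤ p) (hwin : (b 0 + 2 : ℤ) < (p : ℤ) ^ 2) (hfp : FirstPeriod b p)
    (hP : (p : ℤ) ≤ b 7) (hQ : b 0 < (p : ℤ) + b 1 + b 7) (hQ23 : (p : ℤ) + b 2 + b 3 ≤ b 0)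
    (hcas : casoratian b j ≠ 0) :
    dOf b / (p : ℤ) - pairFloors b p - min (if 2 ≤ dOf b / (p : ℤ) then (1 : ℤ) else 0) (5 - (cStar b p : ℤ))
      ≤ padicValRat p (casoratian b j) := by
  by_cases hd3 : dOf b < 3 * (p : ℤ)
  · exact pathAccounting_profile15a b j p hb hs hbj hj1 hj7 hprime hp5 hwin hfp hP hQ hQ23 hd3 hcas
  push Not at hd3
  obtain ⟨hF1, hF2⟩ := fp_bounds hfp
  have hp0 : (0 : ℤ) < p := by exact_mod_cast hprime.pos
  rw [pairFloors_eq_15a hb hs hprime.pos hQ hQ23 hfp]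
  have hC10 : (cStar b p : ℤ) ≤ 10 := by exact_mod_cast cStar_le_ten_15a hs hQ
  have hmin : -5 ≤ min (if 2 ≤ dOf b / (p : ℤ) then (1 : ℤ) else 0) (5 - (cStar b p : ℤ)) :=
    le_min (by split_ifs <;> norm_num) (by linarith)
  have hfd : dOf b / (p : ℤ) < 4 := by rw [Int.ediv_lt_iff_lt_mul hp0]; linarith [(d_bounds15a hs hP hQ hQ23 hF1).2]
  linarith [cas_ge15a_neg7 hb hs hbj hj1 hj7 hprime hp5 hwin hP hQ hQ23 hF1 hF2 hd3 hcas]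

/-- **THE NODE ON THE `N_p = 15` BRANCH `(1,7)`, EVERY SORTED `b`, EVERY `d`** (binders VERBATIM plus the profile inequalities). -/
theorem pathAccountingFirstPeriod_profile15a_all :
    ∀ (b : ℕ → ℤ) (p : ℕ), InPolytope b → Sorted7 b → InPolytope (shift b 7) →
      p.Prime → 5 ≤ p → (b 0 + 2 : ℤ) < (p : ℤ) ^ 2 → FirstPeriod b p →
      (p : ℤ) ≤ b 7 → b 0 < (p : ℤ) + b 1 + b 7 → (p : ℤ) + b 2 + b 3 ≤ b 0 → casoratian b 7 ≠ 0 →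
        dOf b / (p : ℤ) - pairFloors b p - min (if 2 ≤ dOf b / (p : ℤ) then (1 : ℤ) else 0) (5 - (cStar b p : ℤ))
          ≤ padicValRat p (casoratian b 7) :=
  fun b p hb hs hb7 hprime hp5 hwin hfp hP hQ hQ23 hcas =>
    pathAccounting_profile15a_all b 7 p hb hs hb7 (by norm_num) (by norm_num) hprime hp5 hwin hfp hP hQ hQ23 hcas

end Summit.KontsevichZagierPeriods.Zeta5Search.FullProfile
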